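import Summits.QuantumAdvantage.QuantumAdvantage.Theorems.SosSandwichPseudoBoundedAAClassicalCornerAvgCost
import HarnessLib

/-!
# Crux `PseudoBoundedAA` (stmt-QuantumAdvantage-15237, route SosSandwich) — the classical corner in `L¹`-influence currency:
# the LINEAR law `4·Var[p] ≤ Q̄ · maxⱼ E|p − p∘flipⱼ|` (tight at the dictator)

File 8 of the CLASSICAL CORNER of PB-AA.  Files 1–7 state the corner in the route's `L²` influence
`Infⱼ[p] = E (p(x) − p(xʲ))²`, where the law is `16·Var² ≤ Q̄²·maxInf` (exponent pair `(2,2)`); the square comes ONLY from the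
Cauchy–Schwarz passage `E|p − p∘flipⱼ| ≤ √Infⱼ[p]`.  In the `L¹` influence `Inf¹ⱼ[p] := E|p(x) − p(xʲ)|` (the quantity the
O'Donnell–Saks–Schramm–Servedio inequality is really about) the corner law is LINEAR:

* `sum_abs_update_eq_l1Influence` — `Σₓ |p(x^{j→1}) − p(x^{j→0})| = 2^N · E|p − p∘flipⱼ|`;
* **`exists_l1Influence_ge_of_mixture_avgCost`** — if `p` is on the cube a finite mixture of decision trees (`w ≥ 0`) and
  `N ≥ 1`, then `4·Var[p] ≤ Q̄ · E|p − p∘flipⱼ|` for the `j` of largest `L¹` influence, `Q̄ = Σ_k w_k·E_x[cost_{t_k}(x)]`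
  the expected number of queries on a uniform input — exponent pair `(1,1)`, equality for the dictator (`T = 1`);
* `l1Influence_sq_le_influence` — `(E|p − p∘flipⱼ|)² ≤ Infⱼ[p]` (Jensen), recovering the `(2,2)` law of file 6.

Calibration (prose): the `(1,1)` law is tight up to a logarithm on the whole corner — a uniform mixture over `m` disjoint
blocks of a depth-`T` Boolean function all of whose variables are pivotal with probability `≈ (log T)/T` (tribes) has
`Var = 1/(4m)` and every `Inf¹ ≈ (4·Var/T)·log T`.  Honest label: reformulation/calibration of a corner; no stub, crux or summit is closed.
Sources: O'Donnell–Saks–Schramm–Servedio, FOCS 2005, Thm 3.2; Aaronson–Ambainis arXiv:0911.0996 Conj. 6 (the `L¹` form of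
the conjecture, ibid. §4) ; H. K. Lee, ToC 6 (2010).
-/

set_option linter.dupNamespace false

noncomputable section

namespace Summit.QuantumAdvantage.QuantumAdvantage.Theorems.SosSandwich

open Finset Function
open Literature.Computability.Complexity Literature.Computability.QuantumComplexity

namespace ClassicalCorner

variable {N : ℕ}

/-- The `L¹` increment across coordinate `j` is `2^N` times the `L¹` influence `E|p(x) − p(xʲ)|`. [folklore] -/
theorem sum_abs_update_eq_l1Influence (p : MvPolynomial (Fin N) ℝ) (j : Fin N) :
    ∑ x, |evalBool p (update x j true) - evalBool p (update x j false)|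
      = (2 : ℝ) ^ N * boolAvg (fun x => |evalBool p x - evalBool p (flipBit j x)|) := by
  unfold boolAvg
  rw [mul_div_cancel₀ _ (by positivity : (2 : ℝ) ^ N ≠ 0)]
  exact Finset.sum_congr rfl fun x _ => abs_update_sub_eq (evalBool p) j x

/-- The `L¹` influence is nonnegative. [folklore] -/
theorem l1Influence_nonneg (p : MvPolynomial (Fin N) ℝ) (j : Fin N) :
    0 ≤ boolAvg (fun x => |evalBool p x - evalBool p (flipBit j x)|) := by
  unfold boolAvg
  exact div_nonneg (Finset.sum_nonneg fun _ _ => abs_nonneg _) (by positivity)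

/-- **The classical corner in `L¹` currency: the LINEAR law.** If the real polynomial `p` takes on the cube the values of
a finite mixture of decision trees (`w_k ≥ 0`) on `N ≥ 1` bits, then for the variable `j` of largest `L¹` influence
`4·Var[p] ≤ Q̄ · E|p(x) − p(xʲ)|`, where `Q̄ = Σ_k w_k·E_x[cost_{t_k}(x)]` is the expected number of queries on a uniformly
random input; equality for the dictator `p = x₀` (`Var = 1/4`, `Q̄ = 1`, `E|p − p∘flip₀| = 1`).
[cite: OdonnellEtAl2005, Thm 3.2] [cite: AaronsonAmbainis2014, Conj. 6] -/
theorem exists_l1Influence_ge_of_mixture_avgCost {ι : Type*} (s : Finset ι) (w : ι → ℝ) (hw : ∀ k ∈ s, 0 ≤ w k)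
    (t : ι → DecisionTree N) (p : MvPolynomial (Fin N) ℝ)
    (hp : ∀ x, evalBool p x = ∑ k ∈ s, w k * (if (t k).eval x = true then (1 : ℝ) else 0))
    (hN : 0 < N) :
    ∃ j : Fin N, 4 * boolVariance p ≤
      (∑ k ∈ s, w k * ((∑ x, ((t k).cost x : ℝ)) / (2 : ℝ) ^ N)) *
        boolAvg (fun x => |evalBool p x - evalBool p (flipBit j x)|) := by
  classical
  have hne : (Finset.univ : Finset (Fin N)).Nonempty := ⟨⟨0, hN⟩, Finset.mem_univ _⟩
  obtain ⟨j, -, hj⟩ := Finset.exists_max_image Finset.univ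
    (fun j => boolAvg (fun x => |evalBool p x - evalBool p (flipBit j x)|)) hne
  refine ⟨j, ?_⟩
  set I1 : ℝ := boolAvg (fun x => |evalBool p x - evalBool p (flipBit j x)|) with hI1
  have h2N : (0 : ℝ) < (2 : ℝ) ^ N := by positivity
  have hI1nn : 0 ≤ I1 := l1Influence_nonneg p j
  have hMj : ∀ j' : Fin N, ∑ x, |evalBool p (update x j' true) - evalBool p (update x j' false)|
      ≤ (2 : ℝ) ^ N * I1 := fun j' => by
    rw [sum_abs_update_eq_l1Influence]
    exact mul_le_mul_of_nonneg_left (hj j' (Finset.mem_univ _)) h2N.le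
  have key := osss_mixture_cost s w hw t (evalBool p) (evalBool p) hp ((2 : ℝ) ^ N * I1) (by positivity) hMj
  rw [BooleanCorner.sum_sq_sub_sq_sum_eq] at key
  have hQ : ∑ k ∈ s, w k * ∑ x, ((t k).cost x : ℝ)
      = (2 : ℝ) ^ N * ∑ k ∈ s, w k * ((∑ x, ((t k).cost x : ℝ)) / (2 : ℝ) ^ N) := by
    rw [Finset.mul_sum]
    exact Finset.sum_congr rfl fun k _ => by field_simp
  rw [hQ] at key
  have key' : (2 : ℝ) ^ N * ((2 : ℝ) ^ N * (2 * boolVariance p))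
      ≤ (2 : ℝ) ^ N * ((2 : ℝ) ^ N *
          ((∑ k ∈ s, w k * ((∑ x, ((t k).cost x : ℝ)) / (2 : ℝ) ^ N)) * I1 / 2)) := by
    calc (2 : ℝ) ^ N * ((2 : ℝ) ^ N * (2 * boolVariance p))
        = 2 * ((2 : ℝ) ^ N * ((2 : ℝ) ^ N * boolVariance p)) := by ring
      _ ≤ 2 * ((2 : ℝ) ^ N * (∑ k ∈ s, w k * ((∑ x, ((t k).cost x : ℝ)) / (2 : ℝ) ^ N))
            * ((2 : ℝ) ^ N * I1) / 4) := by linarith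
      _ = _ := by ring
  have h := le_of_mul_le_mul_left (le_of_mul_le_mul_left key' h2N) h2N
  linarith

/-- **Jensen step back to the route's currency**: `(E|p − p∘flipⱼ|)² ≤ Infⱼ[p]`, so the linear `L¹` law gives the
`(2,2)` law `16·Var² ≤ Q̄²·maxInf` of file 6 by squaring. [folklore] -/
theorem l1Influence_sq_le_influence (p : MvPolynomial (Fin N) ℝ) (j : Fin N) :
    boolAvg (fun x => |evalBool p x - evalBool p (flipBit j x)|) ^ 2 ≤ influence j p := by
  have h2N : (0 : ℝ) < (2 : ℝ) ^ N := by positivity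
  set d : (Fin N → Bool) → ℝ := fun x => evalBool p x - evalBool p (flipBit j x) with hd
  have hcs : (∑ x, |d x| * 1) ^ 2 ≤ (∑ x, |d x| ^ 2) * ∑ _x : Fin N → Bool, (1 : ℝ) ^ 2 :=
    Finset.sum_mul_sq_le_sq_mul_sq _ _ _
  have hone : ∑ _x : Fin N → Bool, (1 : ℝ) ^ 2 = (2 : ℝ) ^ N := by
    rw [Finset.sum_const, Finset.card_univ, BooleanCorner.card_cube_nat, nsmul_eq_mul]
    push_cast
    ring
  have habs : ∑ x, |d x| ^ 2 = ∑ x, d x ^ 2 := Finset.sum_congr rfl fun x _ => sq_abs _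
  simp only [mul_one] at hcs
  rw [hone, habs] at hcs
  unfold influence boolAvg
  rw [div_pow, div_le_div_iff₀ (by positivity) h2N]
  calc (∑ x, |d x|) ^ 2 * (2 : ℝ) ^ N ≤ ((∑ x, d x ^ 2) * (2 : ℝ) ^ N) * (2 : ℝ) ^ N :=
        mul_le_mul_of_nonneg_right hcs h2N.le
    _ = (∑ x, d x ^ 2) * ((2 : ℝ) ^ N) ^ 2 := by ring

end ClassicalCorner

end Summit.QuantumAdvantage.QuantumAdvantage.Theorems.SosSandwich

end
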